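import Literature.AlgebraicGeometry.Villamayor2007.EliminationInDiffAlgebra
import Mathlib.Algebra.Polynomial.AlgebraMap
import HarnessLib

/-!
# Villamayor 2007, §4 (4eq2) and Thm. 4.11 (ii): the INTERSECTION ALGEBRA `𝒢 ∩ A[W] ⊂ A[W]` of a Rees algebra
# `𝒢 ⊂ B[W]` over a ring extension `A ⊂ B` (a definition), and `R̄_f ⊂ 𝒢 ∩ S[W]` (Thm. 4.11 (ii), one polynomial)

O. E. Villamayor U., *Hypersurface singularities in positive characteristic*, Adv. Math. **213** (2007)
687–733 = arXiv:math/0606796 [Villamayor2007]; locators «p00NN Lnn» = chunk · line of the held arXiv text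
(`lit read paper:arxiv-math_0606796`, chunks p0020, p0022 re-read before typing). Sequel of
`EliminationInDiffAlgebra.lean` (`map_C_mem_of_mem_elimAlgebra`). Campaign `res-hironaka` (D-0089), ladder
rung LIT-6. VOCABULARY + PROOF file: one real definition with unfolding API, NO named facts; nothing of Hironaka's
2017 manuscript is referred to.

## What is typed

* **§4 «On Rees algebras and integral extensions», display (4eq2), p0020 L126–L131.** «Let `A ⊂ B` be a ring
  extension, and `B[{I_nW^n, n ≥ 0}]` a Rees algebra. An inclusion of Rees algebras arises by setting
  `B[{I_nW^n, n ≥ 0}] ∩ A[W] ⊂ B[{I_nW^n, n ≥ 0}]`, where the left hand side is a graded subring of `A[W]`.»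
  TYPED for any `A`-algebra `B` (the «extension» need not be injective) and any `B`-subalgebra `𝒢 ⊂ B[W]`:
  `interAlgebra A 𝒢 := {q ∈ A[W] ; q ↦ B[W] lies in 𝒢}` — the pull-back of `𝒢` along `A[W] → B[W]`
  (`Subalgebra.comap` of Mathlib's `Polynomial.mapAlgHom`), an `A`-subalgebra of `A[W]`; `mem_interAlgebra_iff`.
  (4.4 p0020 L133–L138 and Thm. 4.11 (iii)–(iv) discuss when `𝒢` is finite over it; not typed.)
* **Thm. 4.11 (ii) p0022 L104–L106** «The elimination algebra `R_𝒢` is included in `𝒢̄ ∩ S[W]` (as subalgebras of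
  `S[W]`)», ONE monic polynomial, for every `S[Z]`-subalgebra `𝒢 ⊂ S[Z][W]` containing the weighted Hasse
  derivatives `Δ^e(f)·W^{b−e}` (4.7 (2corth)): `elimAlgebra_le_interAlgebra : R̄_f ≤ 𝒢 ∩ S[W]` and
  `hElimAlgebra_le_interAlgebra` — restatements of `map_C_mem_of_mem_elimAlgebra` in this vocabulary. (Printed for
  `𝒢̄ ⊂ B[W]`, `B = S[Z]/⟨f⟩`, i.e. after reducing modulo `f`; the statement here is the one before reduction,
  `𝒢 ⊂ S[Z][W]`, which implies the printed one by functoriality `interAlgebra_mono_map`.)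

## References

* O. E. Villamayor U., Adv. Math. 213 (2007) 687–733 = arXiv:math/0606796: §4 (4eq2), 4.4, Thm. 4.11.
  [Villamayor2007]
-/

noncomputable section

open scoped Polynomial

namespace Literature.AlgebraicGeometry.Villamayor2007

open MvPolynomial

universe u v w

section Inter

variable (A : Type u) [CommRing A] {B : Type v} [CommRing B] [Algebra A B]

/-- **The intersection algebra `𝒢 ∩ A[W] ⊂ A[W]`** [Villamayor 2007, §4 display (4eq2) p0020 L126–L131 «Let
`A ⊂ B` be a ring extension, and `B[{I_nW^n, n ≥ 0}]` a Rees algebra. An inclusion of Rees algebras arises by setting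
`B[{I_nW^n, n ≥ 0}] ∩ A[W] ⊂ B[{I_nW^n, n ≥ 0}]`, where the left hand side is a graded subring of `A[W]`»]: for an
`A`-algebra `B` and a `B`-subalgebra `𝒢 ⊂ B[W]`, the `A`-subalgebra of those `q ∈ A[W]` whose image in `B[W]` lies in
`𝒢` (pull-back along `A[W] → B[W]`; for `A ⊂ B` injective this is the printed intersection).
[cite: Villamayor2007, §4 (4eq2) p0020 L126–L131] -/
def interAlgebra (𝒢 : Subalgebra B B[X]) : Subalgebra A A[X] :=
  (𝒢.restrictScalars A).comap (Polynomial.mapAlgHom (Algebra.ofId A B))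

variable {A}

/-- Unfolding: `q ∈ 𝒢 ∩ A[W]` iff `q`, mapped to `B[W]`, lies in `𝒢`. [cite: Villamayor2007, §4 (4eq2) p0020 L126–L131] -/
theorem mem_interAlgebra_iff {𝒢 : Subalgebra B B[X]} {q : A[X]} :
    q ∈ interAlgebra A 𝒢 ↔ q.map (algebraMap A B) ∈ 𝒢 := by
  rw [interAlgebra, Subalgebra.mem_comap, Subalgebra.mem_restrictScalars, Polynomial.coe_mapAlgHom]
  rfl

/-- Monotone in `𝒢` («inclusion of Rees algebras», p0020 L112–L115). [cite: Villamayor2007, §4 p0020 L112–L131] -/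
theorem interAlgebra_mono {𝒢 𝒢' : Subalgebra B B[X]} (h : 𝒢 ≤ 𝒢') : interAlgebra A 𝒢 ≤ interAlgebra A 𝒢' :=
  fun _ hq => mem_interAlgebra_iff.mpr (h (mem_interAlgebra_iff.mp hq))

/-- Functoriality in `B` («given rings `B ⊂ B'`, … `I'_n = I_n B'`, also defines a graded extension», (4eq3) p0020
L131–L133): for an `A`-algebra map `φ : B → B'`, `𝒢 ∩ A[W] ⊆ 𝒢' ∩ A[W]` whenever `φ(𝒢) ⊆ 𝒢'` — e.g. `B' = B/⟨f⟩`,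
`𝒢' = 𝒢̄`. [cite: Villamayor2007, §4 (4eq3) p0020 L131–L133] -/
theorem interAlgebra_mono_map {B' : Type w} [CommRing B'] [Algebra A B'] (φ : B →ₐ[A] B') {𝒢 : Subalgebra B B[X]}
    {𝒢' : Subalgebra B' B'[X]} (h : ∀ g ∈ 𝒢, g.map (φ : B →+* B') ∈ 𝒢') :
    interAlgebra A 𝒢 ≤ interAlgebra A 𝒢' := by
  intro q hq
  rw [mem_interAlgebra_iff] at hq ⊢
  have h1 := h _ hq
  rw [Polynomial.map_map] at h1
  have hcomp : (φ : B →+* B').comp (algebraMap A B) = algebraMap A B' := φ.comp_algebraMap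
  rwa [hcomp] at h1

/-- The intersection algebra contains the constants of `𝒢`-degree zero: if `1 ∈ 𝒢` then `A ⊂ 𝒢 ∩ A[W]` — automatic
for a subalgebra; recorded as the graded piece «`I_0 = A`» of a Rees algebra (§2.1 i)). [cite: Villamayor2007, §2.1] -/
theorem C_mem_interAlgebra (𝒢 : Subalgebra B B[X]) (c : A) : Polynomial.C c ∈ interAlgebra A 𝒢 := by
  rw [mem_interAlgebra_iff, Polynomial.map_C]
  exact 𝒢.algebraMap_mem _

end Inter

/-! ## Thm. 4.11 (ii), one monic polynomial: `R̄_f ≤ 𝒢 ∩ S[W]` -/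

section Thm411

variable {k : Type v} [CommRing k] {S : Type w} [CommRing S] [Algebra k S] {b : ℕ}

/-- **Thm. 4.11 (ii) (one monic polynomial): `R̄_f ⊂ 𝒢 ∩ S[W]`** [Villamayor 2007, Thm. 4.11 (ii) p0022 L104–L106
«The elimination algebra `R_𝒢` is included in `𝒢̄ ∩ S[W]` (as subalgebras of `S[W]`)»]: for `f = monicOf a ∈ S[Z]`
and every `S[Z]`-subalgebra `𝒢 ⊂ S[Z][W]` containing the weighted Hasse derivatives `Δ^e(f)·W^{b−e}`, `0 ≤ e ≤ b − 1`
(4.7 (2corth): any differential Rees algebra relative to `S` containing `f·W^b`), the elimination algebra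
`R̄_f = ⊕ I_r W^r ⊂ S[W]` is contained in the intersection algebra `𝒢 ∩ S[W]`.
[cite: Villamayor2007, Thm. 4.11 (ii) p0022 L104–L106] -/
theorem elimAlgebra_le_interAlgebra (a : Fin b → S) (𝒢 : Subalgebra S[X] S[X][X])
    (h𝒢 : ∀ i : Fin b,
      Polynomial.monomial ((i : ℕ) + 1) (Polynomial.hasseDeriv (b - 1 - (i : ℕ)) (monicOf a)) ∈ 𝒢) :
    elimAlgebra k a ≤ interAlgebra S 𝒢 := by
  intro q hq
  rw [mem_interAlgebra_iff, Polynomial.algebraMap_eq]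
  exact map_C_mem_of_mem_elimAlgebra a 𝒢 h𝒢 hq

/-- `ℋ_f ≤ 𝒢 ∩ S[W]` likewise. [cite: Villamayor2007, Thm. 4.11 (ii) p0022 L104–L106] -/
theorem hElimAlgebra_le_interAlgebra (a : Fin b → S) (𝒢 : Subalgebra S[X] S[X][X])
    (h𝒢 : ∀ i : Fin b,
      Polynomial.monomial ((i : ℕ) + 1) (Polynomial.hasseDeriv (b - 1 - (i : ℕ)) (monicOf a)) ∈ 𝒢) :
    hElimAlgebra k a ≤ interAlgebra S 𝒢 :=
  (hElimAlgebra_le_elimAlgebra a).trans (elimAlgebra_le_interAlgebra a 𝒢 h𝒢)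

/-- In particular for the `S[Z]`-algebra GENERATED by the `Δ^e(f)·W^{b−e}` (the one-polynomial instance of 4.7's
`S[Z][{Δ^α(f)W^{n−α}}]`): `R̄_f ≤ S[Z][Δ^e(f)W^{b−e}] ∩ S[W]`. [cite: Villamayor2007, Thm. 4.11 (ii) p0022 L104–L106] -/
theorem elimAlgebra_le_interAlgebra_adjoin_hasseDeriv (a : Fin b → S) :
    elimAlgebra k a ≤ interAlgebra S (Algebra.adjoin S[X] (Set.range fun i : Fin b =>
      Polynomial.monomial ((i : ℕ) + 1) (Polynomial.hasseDeriv (b - 1 - (i : ℕ)) (monicOf a)))) :=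
  elimAlgebra_le_interAlgebra a _ fun i => Algebra.subset_adjoin ⟨i, rfl⟩

end Thm411

end Literature.AlgebraicGeometry.Villamayor2007

end
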